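import Summits.ResolutionOfSingularities.ResolutionOfSingularities.Theorems.UniversalCellsPrimeFieldToPerfectStubTower
import Mathlib.FieldTheory.PurelyInseparable.PerfectClosure
import Mathlib.Algebra.CharP.IntermediateField
import HarnessLib

/-!
# Crux `PrimeModelTransfer` (stmt-ResolutionOfSingularities-8933), line `shared_climb_kernel`:
# stub `stub_towerFromPerfectBase`

Route `ResolutionOfSingularities/UniformComplexity`, crux `PrimeModelTransfer` (resolution of
integral separated finite-type schemes over the algebraically closed fields algebraic over `𝔽_p`
implies the same over every algebraically closed field of characteristic `p`). The registered
skeleton `Cruxes/PrimeModelTransfer/Lines/shared_climb_kernel.lean` (strategist r1, 2026-08-17)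
proves `PrimeModelTransfer` from three stubs: the shared open kernel `stub_climbRatFuncPerf`
(verbatim the kernel of the sibling crux `UniversalCells.PrimeFieldToPerfect`, stmt-15233), THIS
tower stub, and the descent `stub_descentToPerfectExtensions`.

**Statement (`stub_towerFromPerfectBase`, registered signature verbatim).** Let `p` be a prime,
`k₀` a PERFECT field of characteristic `p` over which every integral separated finite-type scheme
has a resolution (`h₀`), and assume the one-transcendental *climb* between perfect fields of
characteristic `p` (`hc`: resolution over a perfect `M` passes to every perfect `L ⊇ M` algebraic
over `M(t)` for some `t ∈ L`). Then for every perfect field `E ⊇ k₀` of characteristic `p` and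
every finite `s ⊆ E`, every integral separated finite-type scheme over the relative perfect
closure `perfectClosure k₀(s) E = {x ∈ E | ∃ n, x ^ (p ^ n) ∈ k₀(s)}` has a resolution.

**Proof** — the landed `Theorems.PrimeFieldToPerfect.stub_tower` (p152147) with the prime field
`ZMod p` replaced by the perfect base `k₀` (its helper lemmas `tower_*` are already stated over a
general base field); no new idea. Inside `E`, for a finite `S ⊆ E` let
`pc(S) = {x ∈ E | ∃ n, x ^ (p ^ n) ∈ k₀(S)}`, a perfect intermediate field of `E / k₀`
(`tower_exists_forall_mem_iff`, `tower_perfectField_of_forall_mem_iff`). By induction on `S`,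
resolution holds over `pc(S)`: the base case is the climb from `k₀` (`h₀`) to `pc(∅)` with `t = 0`
(every `x ∈ pc(∅)` has `x ^ (p ^ n) ∈ k₀(∅) = ⊥ = im k₀`), the step `S ↦ insert t S` is the climb
from `pc(S)` to `pc(insert t S) ∋ t` (every `x` there has `x ^ (p ^ n) ∈ k₀(insert t S) ⊆
pc(S)(t)`, `tower_mem_adjoin_simple_of_mem_adjoin_insert`); algebraicity each time by
`tower_isAlgebraic_of_forall_pow_mem`. Finally one more climb with `t = 0`, from `pc(s)` to the
TARGET field `perfectClosure k₀(s) E` (same elements, but typed as an intermediate field of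
`E / k₀(s)`): every `x` in it has `x ^ (p ^ n) ∈ k₀(s) ⊆ pc(s)`.

[OURS · LADDER-RESOLUTION L1, slot W8.2, kill test K8.2] A route stub of the summit's own route
UniformComplexity; it is NOT a statement of, and attributes nothing to, Hironaka's 2017 manuscript.

Sources: the reduction of resolution problems over perfect fields to perfect closures of finitely
generated subextensions is folklore (Kollár, *Lectures on Resolution of Singularities*, 2007,
Ch. 3, cf. 1.19); the field theory (`perfectClosure`, `mem_perfectClosure_iff_pow_mem`) is
Mathlib's. [folklore]
-/

noncomputable section

set_option linter.dupNamespace false -- mandated namespace of this single-conjunct summit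

open CategoryTheory CategoryTheory.Limits AlgebraicGeometry TopologicalSpace
open Literature.AlgebraicGeometry.Resolution
open Summit.ResolutionOfSingularities.ResolutionOfSingularities.Theorems.PrimeFieldToPerfect
  (tower_isAlgebraic_of_forall_pow_mem tower_perfectField_of_forall_mem_iff
    tower_exists_forall_mem_iff tower_mem_adjoin_simple_of_mem_adjoin_insert)

namespace Summit.ResolutionOfSingularities.ResolutionOfSingularities.Theorems.PrimeModelTransfer

/-- **Tower of climbs from a perfect base** (stub `stub_towerFromPerfectBase` of crux
`PrimeModelTransfer`, registered signature verbatim). Assume resolution of integral separated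
finite-type schemes over a perfect field `k₀` of characteristic `p` (`h₀`) and the *climb* `hc`
(resolution over a perfect `M` of characteristic `p` passes to every perfect `L ⊇ M` of
characteristic `p` algebraic over `M(t)` for some `t ∈ L`). Then resolution holds for integral
separated finite-type schemes over `perfectClosure k₀(s) E` for every perfect `E ⊇ k₀` of
characteristic `p` and every finite `s ⊆ E`. Proof: inside `E`, induct on a finite `S ⊆ E` to get
resolution over the perfect subfield `pc(S) = {x | ∃ n, x ^ (p ^ n) ∈ k₀(S)}` (base and step are
climbs), then climb once more, with `t = 0`, from `pc(s)` to the target `perfectClosure k₀(s) E`,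
whose elements all have a `p ^ n`-th power in `k₀(s) ⊆ pc(s)`. [folklore] -/
theorem stub_towerFromPerfectBase (p : ℕ) (hp : p.Prime)
    (k₀ : Type) [Field k₀] [CharP k₀ p] [PerfectField k₀]
    (h₀ : ∀ (X : Scheme.{0}) (f : X ⟶ Spec (.of k₀)), IsSeparated f → LocallyOfFiniteType f →
      QuasiCompact f → IsIntegral X → Scheme.HasResolution X)
    (hc : ∀ (M : Type) [Field M] [CharP M p] [PerfectField M],
      (∀ (X : Scheme.{0}) (f : X ⟶ Spec (.of M)), IsSeparated f → LocallyOfFiniteType f →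
        QuasiCompact f → IsIntegral X → Scheme.HasResolution X) →
      ∀ (L : Type) [Field L] [CharP L p] [PerfectField L] [Algebra M L] (t : L),
        Algebra.IsAlgebraic (IntermediateField.adjoin M ({t} : Set L)) L →
        ∀ (X : Scheme.{0}) (f : X ⟶ Spec (.of L)), IsSeparated f → LocallyOfFiniteType f →
          QuasiCompact f → IsIntegral X → Scheme.HasResolution X)
    (E : Type) [Field E] [CharP E p] [PerfectField E] [Algebra k₀ E] (s : Finset E)
    (X : Scheme.{0})
    (f : X ⟶ Spec (.of (perfectClosure (IntermediateField.adjoin k₀ (↑s : Set E)) E)))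
    (hs : IsSeparated f) (hl : LocallyOfFiniteType f) (hq : QuasiCompact f) (hX : IsIntegral X) :
    Scheme.HasResolution X := by
  -- adapted from Theorems/UniversalCellsPrimeFieldToPerfectStubTower.lean (p152147)
  classical
  haveI : Fact p.Prime := ⟨hp⟩
  -- ### Resolution over the perfect subfields `pc(S)`, by induction on the finite set `S ⊆ E`
  have key : ∀ (S : Finset E) (M : IntermediateField k₀ E),
      (∀ x : E, x ∈ M ↔ ∃ n : ℕ, x ^ p ^ n ∈ IntermediateField.adjoin k₀ (↑S : Set E)) →
      ∀ (Y : Scheme.{0}) (g : Y ⟶ Spec (.of M)), IsSeparated g → LocallyOfFiniteType g →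
        QuasiCompact g → IsIntegral Y → Scheme.HasResolution Y := by
    intro S
    induction S using Finset.induction_on with
    | empty =>
      -- climb from `k₀` to `pc(∅)` (with `t = 0`)
      intro M hM
      haveI : PerfectField M := tower_perfectField_of_forall_mem_iff p hM
      refine hc k₀ h₀ M (0 : M) (tower_isAlgebraic_of_forall_pow_mem _ fun x => ?_)
      obtain ⟨n, hn⟩ := (hM x.1).1 x.2
      rw [Finset.coe_empty, IntermediateField.adjoin_empty, IntermediateField.mem_bot] at hn
      obtain ⟨c, hc'⟩ := hn
      refine ⟨p ^ n, pow_pos hp.pos n, ?_⟩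
      have hx : x ^ p ^ n = algebraMap k₀ M c := Subtype.ext (by
        rw [IntermediateField.coe_algebraMap_apply, hc']; rfl)
      rw [hx]
      exact IntermediateField.algebraMap_mem _ c
    | insert t S _ ih =>
      -- climb from `pc(S)` to `pc(insert t S)` (with `t = t`)
      intro M hM
      obtain ⟨M', hM'⟩ :=
        tower_exists_forall_mem_iff p (IntermediateField.adjoin k₀ (↑S : Set E))
      have hres' := ih M' hM'
      have hSM' : (↑S : Set E) ⊆ M' := fun x hx =>
        (hM' x).2 ⟨0, by simpa using IntermediateField.subset_adjoin _ _ hx⟩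
      have hle : M' ≤ M := fun x hx => by
        obtain ⟨n, hn⟩ := (hM' x).1 hx
        refine (hM x).2 ⟨n, IntermediateField.adjoin.mono _ _ _ ?_ hn⟩
        rw [Finset.coe_insert]
        exact Set.subset_insert _ _
      have ht : t ∈ M := (hM t).2 ⟨0, by
        simpa using IntermediateField.subset_adjoin _ _ (Set.mem_insert t (↑S : Set E))⟩
      haveI : PerfectField M' := tower_perfectField_of_forall_mem_iff p hM'
      haveI : PerfectField M := tower_perfectField_of_forall_mem_iff p hM
      letI : Algebra M' M := (IntermediateField.inclusion hle).toRingHom.toAlgebra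
      refine hc M' hres' M ⟨t, ht⟩ (tower_isAlgebraic_of_forall_pow_mem _ fun x => ?_)
      obtain ⟨n, hn⟩ := (hM x.1).1 x.2
      refine ⟨p ^ n, pow_pos hp.pos n, ?_⟩
      refine tower_mem_adjoin_simple_of_mem_adjoin_insert (↑S : Set E) t M' M (fun y => rfl)
        hSM' ht (x ^ p ^ n) ?_
      rw [Finset.coe_insert] at hn
      simpa using hn
  -- ### The last climb: from `pc(s)` to the target `perfectClosure k₀(s) E` (with `t = 0`)
  obtain ⟨M₀, hM₀⟩ := tower_exists_forall_mem_iff p (IntermediateField.adjoin k₀ (↑s : Set E))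
  have hres₀ := key s M₀ hM₀
  haveI : PerfectField M₀ := tower_perfectField_of_forall_mem_iff p hM₀
  -- every element of `pc(s)` lies in the target field
  have hMP : ∀ x : E, x ∈ M₀ →
      x ∈ perfectClosure (IntermediateField.adjoin k₀ (↑s : Set E)) E := fun x hx => by
    obtain ⟨n, hn⟩ := (hM₀ x).1 hx
    rw [mem_perfectClosure_iff_pow_mem p]
    exact ⟨n, ⟨x ^ p ^ n, hn⟩, rfl⟩
  -- the inclusion `pc(s) → perfectClosure k₀(s) E` as an algebra structure
  let φ : M₀ →+* perfectClosure (IntermediateField.adjoin k₀ (↑s : Set E)) E :=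
    { toFun := fun y => ⟨(y : E), hMP y y.2⟩
      map_one' := rfl
      map_mul' := fun _ _ => rfl
      map_zero' := rfl
      map_add' := fun _ _ => rfl }
  letI : Algebra M₀ (perfectClosure (IntermediateField.adjoin k₀ (↑s : Set E)) E) := φ.toAlgebra
  refine hc M₀ hres₀ (perfectClosure (IntermediateField.adjoin k₀ (↑s : Set E)) E)
    (0 : perfectClosure (IntermediateField.adjoin k₀ (↑s : Set E)) E)
    (tower_isAlgebraic_of_forall_pow_mem _ fun x => ?_) X f hs hl hq hX
  obtain ⟨n, y, hy⟩ := (mem_perfectClosure_iff_pow_mem p).1 x.2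
  refine ⟨p ^ n, pow_pos hp.pos n, ?_⟩
  have hyM : (y : E) ∈ M₀ := (hM₀ _).2 ⟨0, by simp⟩
  have hx : x ^ p ^ n =
      algebraMap M₀ (perfectClosure (IntermediateField.adjoin k₀ (↑s : Set E)) E) ⟨y, hyM⟩ :=
    Subtype.ext (by
      change (x : E) ^ p ^ n = (y : E)
      exact hy.symm)
  rw [hx]
  exact IntermediateField.algebraMap_mem _ _

end Summit.ResolutionOfSingularities.ResolutionOfSingularities.Theorems.PrimeModelTransfer

end
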